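import Summits.AtomisticToContinuum.FouriersLaw.Theorems.BondHeatUncertaintyExtensiveSnapshotIrreversibilityClausiusBudgetCore
import Summits.AtomisticToContinuum.FouriersLaw.Theorems.BondHeatUncertaintyExtensiveSnapshotIrreversibilityClausiusBudgetEnergy
import Summits.AtomisticToContinuum.FouriersLaw.Theorems.BoundaryEscapeDeficitBoundaryKernelBasics
import Summits.AtomisticToContinuum.FouriersLaw.Theorems.OddSectorIrreversibilityResponseDensityRiesz
import HarnessLib

/-!
# Crux `ExtensiveSnapshotIrreversibility` (stmt-AtomisticToContinuum-9121), line `clausius-budget-sound-window`: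
stub `stub_clausiusBudget` — the Clausius budget `‖k_τ‖²_{L²(μ_T)} ≤ γτ/(4T²)`

Registered stub of the lead's checked skeleton `Cruxes/ExtensiveSnapshotIrreversibility/Lines/clausius-budget-sound-window.lean`
(namespace `…Cruxes.ExtensiveSnapshotIrreversibility.ClausiusBudgetSoundWindow`), proved verbatim (name + signature) so that
`ledger propose --supports stmt-AtomisticToContinuum-9121` accepts it. See the skeleton's module docstring for the line and the
`let`-dictionary (`μT, g, Pg, k, w, Pw`).

Content. For the pinned anharmonic chain at fixed `N ≥ 2` with both baths at `T > 0`, the window response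
`k_τ = ∫₀^τ P_s g ds` of the contact source `g = (γ/2T²)(p_0² - p_{N-1}²)` under the EQUILIBRIUM kernels obeys
`∫ k_τ² dμ_T ≤ γτ/(4T²)` for all `τ ≥ 0`, uniformly in `N` (the lever of the line). The three-line paper
proof (`d/dt ½‖k_t‖² = -γT Σ_b ‖∂_{p_b}k_t‖² + ⟨g, k_t⟩ ≤ γ/(8T²)`) is made rigorous through the CORE
PROPERTY of the equilibrium generator on `C_c^∞` (essential m-dissipativity in `L²(μ_T)`): test functions
`F_n → k_t` with `LF_n → P_t g - g` in `L²(μ_T)` (`pinnedChain_window_core`, support files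
`…ClausiusBudget{Kinetics,Energy,Dissipative,Core}.lean` and `OddSectorIrreversibility…Density.lean`), so the
static contact calculus (a), (b) — hypotheses of the statement, used on the `F_n` only — passes to the limit:
`⟨P_t g, k_t⟩ ≤ γ/(8T²)` for every `t`, and `‖k_τ‖² = 2∫₀^τ ⟨P_t g, k_t⟩ dt` by the fundamental theorem of
calculus (time continuity of `P_t g`) and Fubini. Also `le_of_core_limit`, the `L²` bookkeeping of the limit.

References: N. Cuneo, J.-P. Eckmann, M. Hairer, L. Rey-Bellet, EJP 23 (2018) no. 55, Thm 2.13, §3;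
B. Helffer, F. Nier, *Hypoelliptic Estimates and Spectral Theory for Fokker–Planck Operators and Witten
Laplacians*, LNM 1862 (2005), Prop. 5.5; J.-P. Eckmann, C.-A. Pillet, L. Rey-Bellet, CMP 201 (1999), §3.
-/

noncomputable section

namespace Summit.AtomisticToContinuum.FouriersLaw.Theorems.ExtensiveSnapshotIrreversibility.ClausiusBudget

open MeasureTheory ProbabilityTheory Filter Topology Set
open scoped ENNReal NNReal ContDiff
open Literature.MathematicalPhysics.KineticTheory.HeatConduction
open Literature.MathematicalPhysics.KineticTheory
open Summit.AtomisticToContinuum.FouriersLaw.Theorems.SubdiffusiveBondHeat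

variable {N : ℕ}


/-- **Passing a quadratic bound to an `L²` graph limit.** If `F_n → k` and `LF_n → q` in `L²(μ)`
(`μ` a probability measure, `g ∈ L²(μ)`) and `∫ F_n·LF_n dμ + ∫ g F_n dμ ≤ B` for all `n`, then
`∫ k q dμ + ∫ g k dμ ≤ B` (Cauchy–Schwarz bookkeeping: the pairings are jointly continuous on `L² × L²`).
[folklore] -/
theorem le_of_core_limit {μ : Measure (PhaseSpace N)} {k q g : PhaseSpace N → ℝ}
    (hk : MemLp k 2 μ) (hq : MemLp q 2 μ) (hg : MemLp g 2 μ) {F LF : ℕ → PhaseSpace N → ℝ}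
    (hF : ∀ n, MemLp (F n) 2 μ) (hLF : ∀ n, MemLp (LF n) 2 μ)
    (hu : Tendsto (fun n => ∫ z, (F n z - k z) ^ 2 ∂μ) atTop (𝓝 0))
    (hv : Tendsto (fun n => ∫ z, (LF n z - q z) ^ 2 ∂μ) atTop (𝓝 0)) {B : ℝ}
    (hB : ∀ n, (∫ z, F n z * LF n z ∂μ) + ∫ z, g z * F n z ∂μ ≤ B) :
    (∫ z, k z * q z ∂μ) + ∫ z, g z * k z ∂μ ≤ B := by
  set u : ℕ → PhaseSpace N → ℝ := fun n z => F n z - k z with hudef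
  set w : ℕ → PhaseSpace N → ℝ := fun n z => LF n z - q z with hwdef
  have huL2 : ∀ n, MemLp (u n) 2 μ := fun n => (hF n).sub hk
  have hwL2 : ∀ n, MemLp (w n) 2 μ := fun n => (hLF n).sub hq
  set U : ℕ → ℝ := fun n => ∫ z, (u n z) ^ 2 ∂μ with hU
  set W : ℕ → ℝ := fun n => ∫ z, (w n z) ^ 2 ∂μ with hW
  have hU0 : Tendsto U atTop (𝓝 0) := hu
  have hW0 : Tendsto W atTop (𝓝 0) := hv
  set Q : ℝ := Real.sqrt (∫ z, q z ^ 2 ∂μ)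
  set Kt : ℝ := Real.sqrt (∫ z, k z ^ 2 ∂μ)
  set G : ℝ := Real.sqrt (∫ z, g z ^ 2 ∂μ)
  set s : ℕ → ℝ := fun n => Real.sqrt (U n) * (Real.sqrt (W n) + Q) + Kt * Real.sqrt (W n) +
    G * Real.sqrt (U n) with hs
  have hs0 : Tendsto s atTop (𝓝 0) := by
    have h1 := hU0.sqrt
    have h2 := hW0.sqrt
    rw [Real.sqrt_zero] at h1 h2
    have h := ((h1.mul (h2.add_const Q)).add (h2.const_mul Kt)).add (h1.const_mul G)
    simpa using h
  set Binf : ℝ := (∫ z, k z * q z ∂μ) + ∫ z, g z * k z ∂μ with hBinf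
  have hBn : ∀ n, Binf ≤ B + s n := by
    intro n
    have hB1 := hB n
    have i1 : Integrable (fun z => u n z * (w n z + q z)) μ := (huL2 n).integrable_mul ((hwL2 n).add hq)
    have i2 : Integrable (fun z => k z * w n z) μ := hk.integrable_mul (hwL2 n)
    have i3 : Integrable (fun z => k z * q z) μ := hk.integrable_mul hq
    have i4 : Integrable (fun z => g z * u n z) μ := hg.integrable_mul (huL2 n)
    have i5 : Integrable (fun z => g z * k z) μ := hg.integrable_mul hk
    have i12 : Integrable (fun z => u n z * (w n z + q z) + k z * w n z) μ := i1.add i2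
    have e1 : ∫ z, F n z * LF n z ∂μ =
        (∫ z, k z * q z ∂μ) + ((∫ z, u n z * (w n z + q z) ∂μ) + ∫ z, k z * w n z ∂μ) := by
      rw [← integral_add i1 i2, ← integral_add i3 i12]
      refine integral_congr_ae (Eventually.of_forall fun z => ?_)
      simp only [hudef, hwdef]
      ring
    have e2 : ∫ z, g z * F n z ∂μ = (∫ z, g z * k z ∂μ) + ∫ z, g z * u n z ∂μ := by
      rw [← integral_add i5 i4]
      refine integral_congr_ae (Eventually.of_forall fun z => ?_)
      simp only [hudef]
      ring
    have c1 : |∫ z, u n z * (w n z + q z) ∂μ| ≤ Real.sqrt (U n) * (Real.sqrt (W n) + Q) := by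
      refine (abs_integral_mul_le_sqrt_mul_sqrt (huL2 n) ((hwL2 n).add hq)).trans ?_
      refine mul_le_mul_of_nonneg_left ?_ (Real.sqrt_nonneg _)
      have h := norm_add_le ((hwL2 n).toLp (w n)) (hq.toLp q)
      rw [← MemLp.toLp_add, norm_toLp_two_eq_sqrt, norm_toLp_two_eq_sqrt, norm_toLp_two_eq_sqrt] at h
      exact h
    have c2 : |∫ z, k z * w n z ∂μ| ≤ Kt * Real.sqrt (W n) := abs_integral_mul_le_sqrt_mul_sqrt hk (hwL2 n)
    have c3 : |∫ z, g z * u n z ∂μ| ≤ G * Real.sqrt (U n) := abs_integral_mul_le_sqrt_mul_sqrt hg (huL2 n)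
    rw [hBinf, hs]
    rw [e1, e2] at hB1
    have d1 := neg_abs_le (∫ z, u n z * (w n z + q z) ∂μ)
    have d2 := neg_abs_le (∫ z, k z * w n z ∂μ)
    have d3 := neg_abs_le (∫ z, g z * u n z ∂μ)
    linarith
  have h := hs0.const_add B
  rw [add_zero] at h
  exact ge_of_tendsto' h hBn

/-- **The Clausius budget of the window response** (crux `ExtensiveSnapshotIrreversibility`, line
`clausius-budget-sound-window`, stub `stub_clausiusBudget`). For the pinned anharmonic chain
`P = pinnedChain ω₂ lam β γ` (`ω₂, lam, β, γ > 0`) at fixed `N ≥ 2` with both baths at `T > 0` (equilibrium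
kernels `P_t = P.transitionKernel N T T t`, Gibbs state `μ_T`), the source `g = (γ/2T²)(p_0² - p_{N-1}²)`
and the window response `k_τ = ∫₀^τ P_s g ds`:

  `‖k_τ‖²_{L²(μ_T)} ≤ γ τ / (4 T²)`   for every `τ ≥ 0`, uniformly in `N`.

Hypotheses of the registered statement: uniqueness of steady states (unused), (INV) Gibbs invariance and
(MIX) exponential mixing of the equilibrium kernels (both also proved in the tree and used through it),
the static contact calculus on `C_c^∞` — (a) `∫ F·LF dμ_T = -γT Σ_b ‖∂_{p_b}F‖²` and (b) the Gaussian
integration by parts `∫ (p_b² - T) F dμ_T = T ∫ p_b ∂_{p_b}F dμ_T` — and `k_τ ∈ L²(μ_T)`.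
Proof. (1) For a test function `F`, (a), (b), `∫ p_b² dμ_T = T` and AM–GM with the weight `1/(4T²)` give
`∫ F·LF dμ_T + ∫ g F dμ_T ≤ Σ_b (-γT A_b + γT A_b + γ/(16T²)) = γ/(8T²)` (`A_b = ‖∂_{p_b}F‖²`; the
dissipation absorbs the source EXACTLY). (2) By the core property of the equilibrium generator on test
functions (`pinnedChain_window_core`: essential m-dissipativity of `(L, C_c^∞)` in `L²(μ_T)` — Hörmander
regularity + the energy estimate + dissipativity, files `…ClausiusBudgetRangeDense/Kinetics/Core`) there are
test functions `F_n → k_t`, `LF_n → P_t g - g` in `L²(μ_T)`; passing to the limit in (1),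
`⟨P_t g, k_t⟩_{μ_T} = ⟨(P_t g - g) + g, k_t⟩ ≤ γ/(8T²)` for every `t ≥ 0`. (3) `t ↦ P_t g(z)` is continuous,
so `k_τ(z)² = 2 ∫₀^τ P_t g(z) k_t(z) dt` (fundamental theorem of calculus) and, by Fubini with the weight
`e^{2ϑH} ∈ L¹(μ_T)`, `‖k_τ‖² = 2 ∫₀^τ ⟨P_t g, k_t⟩ dt ≤ 2τ · γ/(8T²) = γτ/(4T²)`.
References: Cuneo–Eckmann–Hairer–Rey-Bellet, EJP 23 (2018) no. 55, Thm 2.13, §3; B. Helffer, F. Nier,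
LNM 1862 (2005), Prop. 5.5; J.-P. Eckmann, C.-A. Pillet, L. Rey-Bellet, CMP 201 (1999), §3.
[cite: CuneoEckmannHairerReyBellet2018, Thm 2.13 and §3.1] -/
theorem stub_clausiusBudget :
    ∀ ω₂ lam β γ : ℝ, 0 < ω₂ → 0 < lam → 0 < β → 0 < γ →
      (∀ (N : ℕ) (T_L T_R : ℝ), 0 < T_L → 0 < T_R → ∀ μ ν : Measure (PhaseSpace N),
        (pinnedChain ω₂ lam β γ).IsSteadyState N T_L T_R μ →
        (pinnedChain ω₂ lam β γ).IsSteadyState N T_L T_R ν → μ = ν) →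
      ∀ T : ℝ, 0 < T → ∀ (N : ℕ) (hN : 2 ≤ N),
        let P := pinnedChain ω₂ lam β γ
        let μT := P.gibbsMeasure N T
        (∀ t : ℝ≥0, μT.bind (P.transitionKernel N T T t) = μT) →
        (∀ ϑ : ℝ, 0 < ϑ → ϑ < 1 / T → ∃ C c : ℝ, 0 < C ∧ 0 < c ∧
          ∀ (z : PhaseSpace N) (t : ℝ≥0) (f : PhaseSpace N → ℝ), Continuous f →
            (∀ y, |f y| ≤ Real.exp (ϑ * P.hamiltonian N y)) →
            |(∫ y, f y ∂(P.transitionKernel N T T t z)) - ∫ y, f y ∂μT| ≤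
              C * Real.exp (ϑ * P.hamiltonian N z) * Real.exp (-c * t)) →
        (∀ f : PhaseSpace N → ℝ, ContDiff ℝ (⊤ : ℕ∞) f → HasCompactSupport f →
          (∫ x, f x * P.generator N T T f x ∂μT =
            -(γ * T) * ∑ i : Fin N, ((if i.val = 0 then (1 : ℝ) else 0) + (if i.val = N - 1 then (1 : ℝ) else 0)) *
              ∫ x, (partialP i f x) ^ 2 ∂μT) ∧
          (∀ i : Fin N, ∫ x, (x.2 i ^ 2 - T) * f x ∂μT = T * ∫ x, x.2 i * partialP i f x ∂μT)) →
        let g : PhaseSpace N → ℝ := fun y =>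
          γ / (2 * T ^ 2) * (y.2 ⟨0, by omega⟩ ^ 2 - y.2 ⟨N - 1, by omega⟩ ^ 2)
        let Pg : ℝ → PhaseSpace N → ℝ := fun s z => ∫ y, g y ∂(P.transitionKernel N T T s.toNNReal z)
        let k : ℝ → PhaseSpace N → ℝ := fun τ z => ∫ s in (0 : ℝ)..τ, Pg s z
        (∀ τ : ℝ, 0 ≤ τ → MemLp (k τ) 2 μT) →
        ∀ τ : ℝ, 0 ≤ τ → ∫ z, (k τ z) ^ 2 ∂μT ≤ γ * τ / (4 * T ^ 2) := by
  intro ω₂ lam β γ hω hl hβ hγ _ T hT N hN P μT _ _ hCalc g Pg k _ τ hτ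
  have hN0 : 0 < N := by omega
  have hN1 : N - 1 < N := by omega
  -- freeze the `let`-bound observables (keep only their defining equations)
  have hg_def : g = fun y : PhaseSpace N => γ / (2 * T ^ 2) * (y.2 ⟨0, hN0⟩ ^ 2 - y.2 ⟨N - 1, hN1⟩ ^ 2) := rfl
  have hPg_def : Pg = fun s z => ∫ y, g y ∂((pinnedChain ω₂ lam β γ).transitionKernel N T T s.toNNReal z) := rfl
  have hk_def : k = fun τ z => ∫ s in (0 : ℝ)..τ, Pg s z := rfl
  clear_value k Pg g
  haveI : IsProbabilityMeasure μT := pinnedChain_isProbabilityMeasure_gibbsMeasure hω hl.le hβ.le γ N hT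
  set b₀ : Fin N := ⟨0, hN0⟩ with hb₀
  set b₁ : Fin N := ⟨N - 1, hN1⟩ with hb₁
  set a : ℝ := γ / (2 * T ^ 2) with ha
  set H := P.hamiltonian N with hH
  have ha0 : 0 ≤ a := by rw [ha]; positivity
  -- the source is nice with `ϑ = 1/(4T)`
  set ϑ : ℝ := 1 / (4 * T) with hϑ
  have hϑ0 : 0 < ϑ := by rw [hϑ]; positivity
  have h2ϑ : 2 * ϑ < 1 / T := by
    rw [hϑ, show 2 * (1 / (4 * T)) = 1 / (2 * T) by field_simp; ring]
    exact one_div_lt_one_div_of_lt hT (by linarith)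
  have hg_apply : ∀ y : PhaseSpace N, g y = a * (y.2 b₀ ^ 2 - y.2 b₁ ^ 2) := fun y => by rw [hg_def]
  have hgc : Continuous g := by
    have hq : ∀ i : Fin N, Continuous fun y : PhaseSpace N => y.2 i := fun i =>
      (continuous_apply i).comp continuous_snd
    rw [hg_def]
    exact continuous_const.mul (((hq b₀).pow 2).sub ((hq b₁).pow 2))
  set Mg : ℝ := a * (2 * (2 / ϑ + T)) with hMg
  have hMg0 : 0 ≤ Mg := by rw [hMg]; positivity
  have hgM : ∀ y, |g y| ≤ Mg * Real.exp (ϑ * H y) := by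
    intro y
    have h0 := abs_sq_momentum_sub_le_exp hω hl.le (γ := γ) (N := N) hβ.le hϑ0 hT.le y b₀
    have h1 := abs_sq_momentum_sub_le_exp hω hl.le (γ := γ) (N := N) hβ.le hϑ0 hT.le y b₁
    rw [hg_apply, show a * (y.2 b₀ ^ 2 - y.2 b₁ ^ 2) = a * ((y.2 b₀ ^ 2 - T) - (y.2 b₁ ^ 2 - T)) by ring,
      abs_mul, abs_of_nonneg ha0, hMg]
    calc a * |y.2 b₀ ^ 2 - T - (y.2 b₁ ^ 2 - T)| ≤ a * (|y.2 b₀ ^ 2 - T| + |y.2 b₁ ^ 2 - T|) :=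
          mul_le_mul_of_nonneg_left (abs_sub _ _) ha0
      _ ≤ a * ((2 / ϑ + T) * Real.exp (ϑ * H y) + (2 / ϑ + T) * Real.exp (ϑ * H y)) := by gcongr
      _ = a * (2 * (2 / ϑ + T)) * Real.exp (ϑ * H y) := by ring
  -- the kinetics package of the window response
  obtain ⟨hcont, ⟨C, hC0, hPgb, hkb⟩, hSM, hkreg, -⟩ :=
    pinnedChain_act_window hω hl.le hβ hγ hN0 hT hϑ0 h2ϑ hMg0 hgc hgM Pg hPg_def k hk_def
  have hk_apply : ∀ t z, k t z = ∫ s in (0 : ℝ)..t, Pg s z := fun t z => by rw [hk_def]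
  have hDir : ∀ F : PhaseSpace N → ℝ, ContDiff ℝ (⊤ : ℕ∞) F → HasCompactSupport F →
      ∫ x, F x * P.generator N T T F x ∂μT =
        -(γ * T) * ∑ i : Fin N, ((if i.val = 0 then (1 : ℝ) else 0) + (if i.val = N - 1 then (1 : ℝ) else 0)) *
          ∫ x, (partialP i F x) ^ 2 ∂μT := fun F hF hFc => (hCalc F hF hFc).1
  have hIBP : ∀ F : PhaseSpace N → ℝ, ContDiff ℝ (⊤ : ℕ∞) F → HasCompactSupport F → ∀ i : Fin N,
      ∫ x, (x.2 i ^ 2 - T) * F x ∂μT = T * ∫ x, x.2 i * partialP i F x ∂μT :=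
    fun F hF hFc i => (hCalc F hF hFc).2 i
  -- square integrability of the momenta
  have hp2I : ∀ i : Fin N, Integrable (fun x : PhaseSpace N => x.2 i ^ 2) μT := by
    intro i
    have h := pinnedChain_integrable_exp_mul_hamiltonian_gibbsMeasure hω hl.le hβ.le γ N hT h2ϑ
    refine (h.const_mul (2 / (2 * ϑ))).mono' (((continuous_apply i).comp continuous_snd).pow 2).aestronglyMeasurable
      (Eventually.of_forall fun x => ?_)
    rw [Real.norm_eq_abs, abs_of_nonneg (sq_nonneg _)]
    have hp := pinnedChain_sq_momentum_le_two_mul_hamiltonian hω hl.le hβ (γ := γ) x i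
    have hH0 : 0 ≤ H x := pinnedChain_hamiltonian_nonneg hω.le hl.le hβ.le γ N x
    have hexp : 2 * ϑ * H x + 1 ≤ Real.exp (2 * ϑ * H x) := Real.add_one_le_exp _
    have h2ϑ0 : 0 < 2 * ϑ := by positivity
    rw [div_mul_eq_mul_div, le_div_iff₀ h2ϑ0]
    nlinarith
  have hp2 : ∀ i : Fin N, ∫ x, x.2 i ^ 2 ∂μT = T := fun i =>
    pinnedChain_integral_sq_momentum_gibbsMeasure hω hl.le hβ.le γ N hT i
  -- STEP 1: the bound on test functions
  have hstep1 : ∀ F : PhaseSpace N → ℝ, ContDiff ℝ (⊤ : ℕ∞) F → HasCompactSupport F →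
      (∫ x, F x * P.generator N T T F x ∂μT) + ∫ x, g x * F x ∂μT ≤ γ / (8 * T ^ 2) := by
    intro F hF hFc
    have hF2 : ContDiff ℝ 2 F := hF.of_le (by norm_cast)
    have hFd : Differentiable ℝ F := hF2.differentiable (by norm_num)
    have hFcont : Continuous F := hF.continuous
    set dF : Fin N → PhaseSpace N → ℝ := fun i x => partialP i F x with hdF
    have hdFc : ∀ i, Continuous (dF i) := fun i => continuous_partialP hF (by simp) i
    have hdFs : ∀ i, HasCompactSupport (dF i) := fun i => hasCompactSupport_partialP hFd hFc i
    have hA2 : ∀ i, Integrable (fun x => (dF i x) ^ 2) μT := fun i =>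
      ((hdFc i).memLp_of_hasCompactSupport (hdFs i)).integrable_sq
    set A : Fin N → ℝ := fun i => ∫ x, (dF i x) ^ 2 ∂μT with hA
    set J : Fin N → ℝ := fun i => ∫ x, x.2 i * dF i x ∂μT with hJ
    have hA0 : ∀ i, 0 ≤ A i := fun i => integral_nonneg fun x => sq_nonneg _
    -- (a)
    have ha' : ∫ x, F x * P.generator N T T F x ∂μT = -(γ * T) * (A b₀ + A b₁) := by
      rw [hDir F hF hFc, sum_contactWeight_mul hN0]
    -- the source through (b)
    have hq : ∀ i : Fin N, Continuous fun y : PhaseSpace N => y.2 i := fun i =>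
      (continuous_apply i).comp continuous_snd
    have hIi : ∀ i : Fin N, Integrable (fun x => (x.2 i ^ 2 - T) * F x) μT := fun i =>
      ((((hq i).pow 2).sub continuous_const).mul hFcont).integrable_of_hasCompactSupport hFc.mul_left
    have hgF : ∫ x, g x * F x ∂μT = a * (T * J b₀ - T * J b₁) := by
      have e : (fun x => g x * F x) = fun x => a * ((x.2 b₀ ^ 2 - T) * F x - (x.2 b₁ ^ 2 - T) * F x) := by
        funext x; rw [hg_apply]; ring
      rw [e, integral_const_mul, integral_sub (hIi b₀) (hIi b₁), hIBP F hF hFc b₀, hIBP F hF hFc b₁]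
    -- AM–GM with the weight `ε = 1/(4T²)`
    set ε : ℝ := 1 / (4 * T ^ 2) with hε
    have hε0 : 0 < ε := by rw [hε]; positivity
    have hJb : ∀ i, |J i| ≤ (ε * T + ε⁻¹ * A i) / 2 := by
      intro i
      have h := abs_integral_mul_le_weighted (hp2I i) (hA2 i) hε0
      rw [hp2 i] at h
      exact h
    have hkey : ∀ i, a * T * |J i| ≤ γ / (16 * T ^ 2) + γ * T * A i := by
      intro i
      have h1 := mul_le_mul_of_nonneg_left (hJb i) (by positivity : 0 ≤ a * T)
      have e1 : a * T * ((ε * T + ε⁻¹ * A i) / 2) = γ / (16 * T ^ 2) + γ * T * A i := by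
        rw [ha, hε]
        field_simp
        ring
      linarith
    have hc0 : a * (T * J b₀) ≤ a * T * |J b₀| := by
      rw [← mul_assoc]; exact mul_le_mul_of_nonneg_left (le_abs_self _) (by positivity)
    have hc1 : -(a * (T * J b₁)) ≤ a * T * |J b₁| := by
      rw [← mul_assoc, ← mul_neg]; exact mul_le_mul_of_nonneg_left (neg_le_abs _) (by positivity)
    rw [ha', hgF]
    have e2 : γ / (8 * T ^ 2) = γ / (16 * T ^ 2) + γ / (16 * T ^ 2) := by field_simp; ring
    nlinarith [hkey b₀, hkey b₁, hA0 b₀, hA0 b₁]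
  -- STEP 2: the bound at every time `t ≥ 0`
  have hHc : Continuous H := pinnedChain_continuous_hamiltonian ω₂ lam β γ N
  have hVc : Continuous fun z => Real.exp (ϑ * H z) := Real.continuous_exp.comp (continuous_const.mul hHc)
  have hexp2 : MemLp (fun z => Real.exp (ϑ * H z)) 2 μT := by
    rw [memLp_two_iff_integrable_sq hVc.aestronglyMeasurable]
    refine (pinnedChain_integrable_exp_mul_hamiltonian_gibbsMeasure hω hl.le hβ.le γ N hT h2ϑ).congr
      (Eventually.of_forall fun z => ?_)
    change Real.exp (2 * ϑ * H z) = Real.exp (ϑ * H z) ^ 2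
    rw [sq, ← Real.exp_add]; congr 1; ring
  have hL2 : ∀ {f : PhaseSpace N → ℝ} (K : ℝ), StronglyMeasurable f →
      (∀ z, |f z| ≤ K * Real.exp (ϑ * H z)) → MemLp f 2 μT := fun K hf hb =>
    hexp2.of_le_mul (c := K) hf.aestronglyMeasurable (Eventually.of_forall fun z => by
      rw [Real.norm_eq_abs, Real.norm_eq_abs, abs_of_pos (Real.exp_pos _)]; exact hb z)
  have hgL2 : MemLp g 2 μT := hL2 Mg hgc.stronglyMeasurable hgM
  have hPgL2 : ∀ t, MemLp (Pg t) 2 μT := fun t => hL2 C (hSM.comp_measurable measurable_prodMk_left) (hPgb t)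
  have hstep2 : ∀ t : ℝ, 0 ≤ t → ∫ z, Pg t z * k t z ∂μT ≤ γ / (8 * T ^ 2) := by
    intro t ht
    obtain ⟨hkSM, hkL2⟩ := hkreg t ht
    obtain ⟨Fs, hFs, hu, hv⟩ := pinnedChain_window_core hω hl.le hβ hγ hN0 hT hϑ0 h2ϑ hMg0 hgc hgM Pg hPg_def k hk_def
      hN ht
    have hU1 : ContDiff ℝ 1 P.U := pinnedChain_contDiff_U ω₂ lam β γ
    have hV1 : ContDiff ℝ 1 P.V := pinnedChain_contDiff_V ω₂ lam β γ
    have hqL2 : MemLp (fun z => Pg t z - g z) 2 μT := (hPgL2 t).sub hgL2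
    have hFL2 : ∀ n, MemLp (Fs n) 2 μT := fun n =>
      (hFs n).1.continuous.memLp_of_hasCompactSupport (hFs n).2
    have hLFL2 : ∀ n, MemLp (P.generator N T T (Fs n)) 2 μT := fun n =>
      (P.continuous_generator hU1 hV1 N T T ((hFs n).1.of_le (by norm_cast))).memLp_of_hasCompactSupport
        (P.hasCompactSupport_generator N T T ((hFs n).1.of_le (by norm_cast)) (hFs n).2)
    have hlim := le_of_core_limit hkL2 hqL2 hgL2 hFL2 hLFL2 hu hv (fun n => hstep1 (Fs n) (hFs n).1 (hFs n).2)
    have i3 : Integrable (fun z => k t z * (Pg t z - g z)) μT := hkL2.integrable_mul hqL2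
    have i5 : Integrable (fun z => g z * k t z) μT := hgL2.integrable_mul hkL2
    have e3 : ∫ z, Pg t z * k t z ∂μT = (∫ z, k t z * (Pg t z - g z) ∂μT) + ∫ z, g z * k t z ∂μT := by
      rw [← integral_add i3 i5]
      refine integral_congr_ae (Eventually.of_forall fun z => ?_)
      ring
    rw [e3]
    exact hlim
  -- STEP 3: `k_τ(z)² = 2 ∫₀^τ P_t g(z) k_t(z) dt`
  have hderiv : ∀ z x, HasDerivAt (fun x => k x z) (Pg x z) x := by
    intro z x
    have e : (fun x => k x z) = fun x => ∫ s in (0 : ℝ)..x, Pg s z := funext fun x => hk_apply x z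
    rw [e]
    exact intervalIntegral.integral_hasDerivAt_right ((hcont z).intervalIntegrable _ _)
      ((hcont z).stronglyMeasurableAtFilter _ _) (hcont z).continuousAt
  have hkc : ∀ z, Continuous fun x => k x z := fun z =>
    continuous_iff_continuousAt.2 fun x => (hderiv z x).continuousAt
  have hsq : ∀ z, (k τ z) ^ 2 = 2 * ∫ t in (0 : ℝ)..τ, Pg t z * k t z := by
    intro z
    have hd : ∀ x ∈ uIcc (0 : ℝ) τ, HasDerivAt (fun x => (k x z) ^ 2) (2 * (Pg x z * k x z)) x := by
      intro x _
      have h := (hderiv z x).pow 2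
      refine h.congr_deriv ?_
      simp only [Nat.cast_ofNat]
      ring
    have hint : IntervalIntegrable (fun x => 2 * (Pg x z * k x z)) volume 0 τ :=
      (continuous_const.mul ((hcont z).mul (hkc z))).intervalIntegrable _ _
    have h := intervalIntegral.integral_eq_sub_of_hasDerivAt hd hint
    rw [intervalIntegral.integral_const_mul] at h
    have h0 : k 0 z = 0 := by rw [hk_apply, intervalIntegral.integral_same]
    rw [h0] at h
    simp only [ne_eq, OfNat.ofNat_ne_zero, not_false_eq_true, zero_pow, sub_zero] at h
    linarith
  -- STEP 4: Fubini and the conclusion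
  have hkSM_all : ∀ t : ℝ, StronglyMeasurable (k t) := by
    intro t
    rcases le_or_gt 0 t with ht | ht
    · exact (hkreg t ht).1
    · have e : k t = fun z => -∫ s in Ioc t 0, Pg s z := by
        funext z
        rw [hk_apply, intervalIntegral.integral_symm, intervalIntegral.integral_of_le ht.le]
      rw [e]
      exact (StronglyMeasurable.integral_prod_left' (μ := volume.restrict (Ioc t 0)) hSM).neg
  have hkjoint : StronglyMeasurable (Function.uncurry k) :=
    stronglyMeasurable_uncurry_of_continuous_of_stronglyMeasurable hkc hkSM_all
  have hkb' : ∀ (t : ℝ) z, |k t z| ≤ |t| * C * Real.exp (ϑ * H z) := by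
    intro t z
    rw [hk_apply, ← Real.norm_eq_abs]
    have h := intervalIntegral.norm_integral_le_of_norm_le_const (a := 0) (b := t) (C := C * Real.exp (ϑ * H z))
      (f := fun s => Pg s z) (fun s _ => by rw [Real.norm_eq_abs]; exact hPgb s z)
    rw [sub_zero] at h
    calc _ ≤ C * Real.exp (ϑ * H z) * |t| := h
      _ = |t| * C * Real.exp (ϑ * H z) := by ring
  have hI2ϑ := pinnedChain_integrable_exp_mul_hamiltonian_gibbsMeasure hω hl.le hβ.le γ N hT h2ϑ
  have hprod : Integrable (fun p : ℝ × PhaseSpace N => Pg p.1 p.2 * k p.1 p.2)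
      ((volume.restrict (Ioc (0 : ℝ) τ)).prod μT) := by
    haveI : IsFiniteMeasure (volume.restrict (Ioc (0 : ℝ) τ)) := ⟨by
      rw [Measure.restrict_apply_univ]; exact measure_Ioc_lt_top⟩
    have hf1 : Integrable (fun t : ℝ => |t| * C ^ 2) (volume.restrict (Ioc (0 : ℝ) τ)) :=
      (continuous_abs.mul continuous_const).integrableOn_Ioc
    refine Integrable.mono' (hf1.mul_prod hI2ϑ) ((hSM.mul hkjoint).aestronglyMeasurable)
      (Eventually.of_forall fun p => ?_)
    rw [Real.norm_eq_abs, abs_mul]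
    have h1 := hPgb p.1 p.2
    have h2 := hkb' p.1 p.2
    have e : |p.1| * C ^ 2 * Real.exp (2 * ϑ * H p.2) =
        (C * Real.exp (ϑ * H p.2)) * (|p.1| * C * Real.exp (ϑ * H p.2)) := by
      rw [show 2 * ϑ * H p.2 = ϑ * H p.2 + ϑ * H p.2 by ring, Real.exp_add]; ring
    rw [e]
    exact mul_le_mul h1 h2 (abs_nonneg _) (by positivity)
  have hswap : ∫ z, (∫ t in Ioc (0 : ℝ) τ, Pg t z * k t z) ∂μT = ∫ t in Ioc (0 : ℝ) τ, (∫ z, Pg t z * k t z ∂μT) :=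
    integral_integral_swap hprod.swap
  have hinner : IntegrableOn (fun t => ∫ z, Pg t z * k t z ∂μT) (Ioc (0 : ℝ) τ) := hprod.integral_prod_left
  calc ∫ z, (k τ z) ^ 2 ∂μT = ∫ z, 2 * (∫ t in Ioc (0 : ℝ) τ, Pg t z * k t z) ∂μT := by
        refine integral_congr_ae (Eventually.of_forall fun z => ?_)
        show k τ z ^ 2 = 2 * ∫ t in Ioc (0 : ℝ) τ, Pg t z * k t z
        rw [hsq z, intervalIntegral.integral_of_le hτ]
    _ = 2 * ∫ t in Ioc (0 : ℝ) τ, (∫ z, Pg t z * k t z ∂μT) := by rw [integral_const_mul, hswap]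
    _ ≤ 2 * ∫ t in Ioc (0 : ℝ) τ, γ / (8 * T ^ 2) := by
        refine mul_le_mul_of_nonneg_left (setIntegral_mono_on hinner ?_ measurableSet_Ioc
          fun t ht => hstep2 t ht.1.le) (by norm_num)
        exact (continuous_const.integrableOn_Ioc)
    _ = γ * τ / (4 * T ^ 2) := by
        rw [setIntegral_const, Real.volume_real_Ioc_of_le hτ, sub_zero, smul_eq_mul]
        ring

end Summit.AtomisticToContinuum.FouriersLaw.Theorems.ExtensiveSnapshotIrreversibility.ClausiusBudget

end
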